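import Mathlib
import HarnessLib
import HarnessLib.Audit
import Summits.Parity.Statement
import HarnessLib.Audit.Status.Attr

/-!
Route: JordanCorner

DORMANT since 2026-08-24T01:10:31Z (reconciler: no traction for 6.4 d (last activity item-evidence-added at 2026-08-17T14:53:27Z); parked, not closed — `ledger route dormant route-Parity-JordanCorner --off` to reactivate) — unstaffed, not closed; items shared with open routes are served there. `ledger route dormant <id> --off` reactivates.

# Route JordanCorner — GHL at d = 1 as the corner Taylor coefficient of the uniform Jordan
deformation, extracted by two constants

X = DiscGrowth (card Parity/GeneralizedHardyLittlewood/parity-corner-vitali, re-typed so that the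
deduction reaches the sub-problem
Statement). For a d = 1 system Ψ = (a_1 n + b_1, …, a_t n + b_t), a convex K ⊆ [−N, N] and z ∈ ℂ put
J̃_z(m) := Σ_{d | m} μ(d) d^{−z}
(m ≥ 2; 0 for m ≤ 1) and S_{Ψ,K,N}(z) := Σ_{n ∈ K ∩ ℤ} Π_i J̃_z(ψ_i(n)). Each factor vanishes at z =
0 with derivative Λ(ψ_i(n)), so S is
ENTIRE, vanishes to order t at the corner z = 0, and (1/t!) S^{(t)}(0) = vonMangoldtSum Ψ K N
EXACTLY (CornerIdentity). On Re z ≥ σ > 0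
the divisor expansion converges absolutely and S = β_∞(Ψ,K)·G_Ψ(z) + O(N^{1−η}) UNIFORMLY in ‖Ψ‖_N ≤
L and K (TrivialRegion), where
G_Ψ(z) = Σ_d Π_i μ(d_i) d_i^{−z} dens_Ψ(d) = ζ(1+z)^{−t} H_Ψ(z) continues to |z| < ρ₀ with t-th
Taylor coefficient Π_p β_p(Ψ) =
singularProduct Ψ and sub-polynomial growth N^{o(1)} (CornerContinuation). It suffices to show X =
DiscGrowth: for every t ≥ 2 and L
there is ρ > 0 with |S_{Ψ,K,N}(z)| ≤ N^{1+κ} on ‖z‖ ≤ ρ for every κ > 0, N ≥ N₀(κ), uniformly in Ψ,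
K. Then Hadamard's three circles +
Cauchy (TwoConstants) force (1/t!)|S^{(t)}(0) − β_∞ G_Ψ^{(t)}(0)| ≤ C N^{1+κ(1−θ)−ηθ} = o(N), i.e.
the d = 1 statement of
Green–Tao Conj. 1.2 (Dickson–Hardy–Littlewood with Λ-weights, uniform in shifts ≤ LN; = the shared
node DimOne of the sibling
routes, stmt-Parity-0819) for t ≥ 2; t = 1 is Siegel–Walfisz (SinglesDimOne); d = 1 → GHL is the
fibration lemma, PROVED in the
tree
(Summit.Parity.GeneralizedHardyLittlewood.Theorems.FibrationGlue.generalizedHardyLittlewood_of_dimOne,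
= stmt-Parity-0822),
so the route's assembly item (Assembly, restated in rev 2) runs the extraction straight to the
Statement and the route carries no
summit-equivalent waypoint
(DimOne ⟺ GHL is the tree theorem Theorems.EngineToGHL.generalizedHardyLittlewood_iff_dimOne; rev-2
repair 2026-08-17).
Lean: `∀ t : ℕ, 2 ≤ t → ∀ L : ℕ, ∃ ρ : ℝ, 0 < ρ ∧ ∀ κ : ℝ, 0 < κ → ∃ N₀ : ℕ, ∀ N : ℕ, N₀ ≤ N → ∀ Ψ :
Fin t → Literature.NumberTheory.Sieve.AffLinForm 1,
Literature.NumberTheory.Sieve.IsNondegenerateSystem Ψ → Literature.NumberTheory.Sieve.affLinSize Ψ N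
≤ L → ∀ K : Set (Fin 1 → ℝ), Convex ℝ K → K ⊆ Literature.NumberTheory.Sieve.realBox 1 N → ∀ z : ℂ,
‖z‖ ≤ ρ → ‖∑ n ∈ (Literature.NumberTheory.Sieve.latticeBox 1 N).filter (fun n =>
Literature.NumberTheory.Sieve.realPoint n ∈ K), ∏ i : Fin t, (if (Ψ i).eval n < 2 then (0 : ℂ) else
∑ d ∈ Nat.divisors ((Ψ i).eval n).toNat, (ArithmeticFunction.moebius d : ℂ) * ((d : ℕ) : ℂ) ^ (-z))‖
≤ (N : ℝ) ^ (1 + κ)`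

## Assembly
The item Assembly (rank 1, restated in rev 2) is the route's own provable theorem: DiscGrowth →
TrivialRegion → CornerContinuation →
CornerIdentity → TwoConstants → SinglesDimOne → GeneralizedHardyLittlewood (the corner extraction to
the d = 1 statement for all t,
followed by the proved fibration theorem). The deciding theorem in glue.lean is `closes (h2 :
DiscGrowth) (h5 : TrivialRegion)
(h6 : CornerContinuation) (h7 : CornerIdentity) (h8 : TwoConstants) (h9 : SinglesDimOne) (hA :
Assembly) :
_root_.GeneralizedHardyLittlewood := hA h2 h5 h6 h7 h8 h9`; every binder is consumed. TwinDiscGrowth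
is the kill node, wired to the
load-bearing crux by the kill-path support TwinKill : ¬TwinDiscGrowth → ¬DiscGrowth (contrapositive
of the L = 3 slice); it is not
a hypothesis of closes.

Rationale: WHY THIS LINE. Mechanism (card parity-corner-vitali): analytic continuation in the RANK variable z
of the Λ_k hierarchy (Σ_k Λ_k z^k/k! = J_z = μ∗N^z,
BombieriAsymptoticSieve1976: Type-I data fix k ≥ 2 and leave k = 1 free) — the prime-tuple sum is
the corner Taylor coefficient of a
family that is trivially understood on the open quadrant Re z > 0, and a main-term-free
sub-polynomial BOUND on a small disc is
converted into the ASYMPTOTIC with the right constant by complex function theory; the constant Π_p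
β_p is computed from ζ(1+z)^{−t},
never assumed, and no major arc, level of distribution or sieve identity enters. What is new
relative to the retired gen-1 route
ParityCorner (closed not-a-thesis: its assembly stopped at fixed-shift pairs): (i) the deformation
is typed for t-tuples of forms
a_i n + b_i UNIFORMLY in the shifts |b_i| ≤ L·N and in convex K, exactly the uniformity Green–Tao
Conj. 1.2 builds into ‖Ψ‖_N ≤ L
(Goldbach-type systems (n, M − n) included), so the glue reaches the d = 1 statement and, through
the fibration lemma (PROVED in
the tree since 2026-08-16: Theorems.FibrationGlue.generalizedHardyLittlewood_of_dimOne), the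
Statement; (ii) uniform O(1) disc bounds being false over primorial shifts (G_Ψ(−ρ) ≍
exp((log N)^{tρ})), the crux is sub-polynomial growth N^{1+κ}, under which the right half-disc is
free and the whole parity content
sits on Re z < 0 (a power saving N^{t|Re z|−κ} in a (−1)^{ω}-signed t-fold correlation); (iii) the
extraction is QUANTITATIVE
(two-constants: Hadamard three circles + Cauchy, Titchmarsh1986 §§5.3, 9.1; AhlforsCA1979) instead
of Vitali–Montel, which is what
makes uniformity in (Ψ, K) automatic. Sources: Tenenbaum2015 II.5 (Selberg–Delange: Cauchy
extraction in a complex exponent,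
one-point), arXiv:0807.4739 (mod-φ convergence: uniform control on a complex disc ⇒ fine
asymptotics), Golomb1970 (Λ-calculus:
Λ(n)Λ(n+h) = ½Λ₂(n(n+h)), stuck at an Abel-variable interchange), Ingham1942 / arXiv:1609.01411
(shifted sums of divisor-type
functions = the trivial region), arXiv:1603.08453 (Klurman: local-factor asymptotics for
correlations of bounded pretentious
functions — the bounded case of the axis probe recorded under NOT DECOMPOSED YET (v)), TaoFMP2016 /
SawinShusterman2018 (what is known for μ-signed binary sums over ℤ /
F_q[T]). Area imported: complex analysis of holomorphic families (harmonic-measure interpolation);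
no probabilistic, spectral or
physical reformulation. Negatives index at filing (PrimeDeterminantCells
ConvMomentLevelOne, ShiftedMultiplicationTable RectangleChowla — degenerate-window misstatements)
does not touch these statements;
every window here is closed (‖z‖ ≤ ρ, ρ existential, ∀ κ ∃ N₀, t ≥ 2).

RANKED CRUXES. #2 DiscGrowth (crux) — (card Crux 1 = H(ρ), uniformised and in growth form) for every
t ≥ 2 and L there is ρ > 0 such that for every κ > 0, all N ≥ N₀(t,L,κ), every non-degenerate Ψ =
(a_i n + b_i)_{i<t} with ‖Ψ‖_N ≤ L, every convex K ⊆ [−N, N] and every ‖z‖ ≤ ρ: |Σ_{n ∈ K∩ℤ} Π_i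
J̃_z(ψ_i(n))| ≤ N^{1+κ}, J̃_z(m) = Σ_{d|m} μ(d) d^{−z} for m ≥ 2 (0 otherwise). Trivial for Re z ≥ 0
(divisor bound); at z = −σ' < 0 the trivial bound is N^{1+tσ'+o(1)} and J̃_{−σ'}(m) = Π_{p|m}(1 −
p^{σ'}) = (−1)^{ω(m)}·(positive weight ≤ m^{σ'}), so the content is a power saving N^{tσ'−κ} in a
Liouville-type signed t-fold correlation of linear forms, uniformly in shifts ≤ L·N and intervals —
supplied as a pure BOUND with no main term and no singular series. [difficulty: open-problem] (why
it might fail: GRH+power-Chowla strength: a power saving in a (−1)^ω-signed t-fold correlation,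
uniform in shifts ≤ LN (none known over ℤ; its t=1 analogue is quasi-GRH); a Siegel zero mod q ≤
N^{tρ−κ} aligned with the shifts would violate it.) [TaoFMP2016, SawinShusterman2018,
BombieriAsymptoticSieve1976, MatomakiMerikoski2023, arXiv:2109.06291,
Literature.Barriers.Parity.SelbergParityBarrier,
Literature.Barriers.Parity.SiegelZeroPrimePairBarrier]
#3 TwinDiscGrowth (crux) — the twin slice (t = 2, Ψ = (n, n+2), K = [2, N]) of DiscGrowth, filed
separately as the route's falsifier node and first milestone: there is ρ > 0 such that for every κ >
0 and N ≥ N₀(κ), sup_{‖z‖ ≤ ρ} |Σ_{2 ≤ n ≤ N} J̃_z(n) J̃_z(n+2)| ≤ N^{1+κ}. Implied by DiscGrowth (L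
= 3); by the fixed-shift corner argument (gen-1 TrivialRegion + CornerContinuation + TwoConstants)
it gives Σ_{n ≤ N} Λ(n)Λ(n+2) = 2C₂N + O(N^{1−c}), so it is at least power-saving twin-HL strong; it
is the statement the kit numerics test; wired to the load-bearing crux by the kill-path support
TwinKill (¬TwinDiscGrowth → ¬DiscGrowth), so its refutation is machine-visibly ¬DiscGrowth.
[difficulty: open-problem] (why it might fail: at z=−ρ it is a power saving N^{2ρ−κ} for
Σ(−1)^{ω(n)+ω(n+2)}w(n)w(n+2): nothing beyond log-averaged o(1) is known for binary Liouville sums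
over ℤ (TaoFMP2016); it forces power-saving twin HL, so any Ω-result beyond √N kills it.)
[TaoFMP2016, HardyLittlewood1923, SawinShusterman2018, MatomakiRadziwillTao2019]
#9 TrivialRegion (support) — PROVABLE NOW (uniform (K) with a power rate): for t ≥ 1, L, σ > 0 there
are η = η(t,L,σ) > 0 and N₀ with ‖S_{Ψ,K,N}(z) − archFactor(Ψ,K)·G_Ψ(z)‖ ≤ N^{1−η} for all N ≥ N₀,
all non-degenerate Ψ with ‖Ψ‖_N ≤ L, all convex K ⊆ [−N,N] and all z with Re z ≥ σ, |z| ≤ 1, where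
G_Ψ(z) = Σ_{d : Fin t → ℕ} Π_i μ(d_i) d_i^{−z}·dens_Ψ(d), dens_Ψ(d) = #{m mod Π d_i : d_i | ψ_i(m) ∀
i}/Π d_i (absolutely convergent for Re z > 0). Proof: truncate each J̃ at d ≤ y = N^{1/(2t)} (tail ≤
τ(m) y^{−σ}, Σ_n Π τ(ψ_i(n)) ≤ N^{1+o(1)}); the head is a sum over admissible classes mod Π d_i of
lattice points of the interval K ∩ {ψ_i ≥ 2} (count = length·dens + O(#classes + 1), #classes ≤ C_L
Π d_i/lcm, Σ_{d ≤ y} Π d_i/lcm ≪ y^t log^c y); |length − archFactor| ≤ 2t; series tail ≪ y^{−σ}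
log^c; total ≪ N^{1−σ/(2t)+o(1)} + N^{1/2+o(1)}. [difficulty: provable-now] [Ingham1942,
Tenenbaum2015, MontgomeryVaughan2007, GreenTao2010]
#9 CornerContinuation (support) — PROVABLE NOW: for t ≥ 1 and L there is ρ₀ > 0 (ρ₀ = min(1/(4t),
r_ζ) works, r_ζ a radius on which z ζ(1+z) ≠ 0) such that for every κ > 0, N ≥ N₀(t,L,κ) and
non-degenerate Ψ with ‖Ψ‖_N ≤ L there is G holomorphic on |z| < ρ₀ with: G = G_Ψ (the series of
TrivialRegion) where Re z > 0; G^{(t)}(0) = t!·singularProduct Ψ; |G| ≤ N^κ on the ball. Proof: CRT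
makes d ↦ Π μ(d_i) dens_Ψ(d) multiplicative, G_Ψ(z) = Π_p E_p(z), E_p(z) = Σ_{I ⊆ [t]} (−1)^{|I|}
p^{−|I|z} ν_p(I)/p (ν_p(I) = #{m mod p : p | ψ_i(m), i ∈ I}, ν_p(∅)/p := 1); for p ∤ Π a_i
Π_{i<j}(a_i b_j − a_j b_i): E_p = 1 − t p^{−1−z}, so G = ζ(1+z)^{−t} H_Ψ, H_Ψ = Π_p E_p(1 −
p^{−1−z})^{−t} absolutely convergent on Re z > −1/2; ζ(1+z)^{−1} = z + O(z²) gives G^{(t)}(0) = t!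
H_Ψ(0) = t! Π_p β_p(Ψ) (β_p = (1−1/p)^{−t} Σ_I (−1)^{|I|} ν_p(I)/p by inclusion–exclusion =
localFactor; ordered product = singularProduct via tendsto_singularProductPartial_holds); growth:
bad primes p > L have ν_p(I) ≤ 1, so |E_p(1−p^{−1−z})^{−t}| ≤ exp(C_t p^{tρ₀−1}) and |H_Ψ| ≤ exp(C
(log N)^{1/4}) ≤ N^κ. [difficulty: provable-now] [Tenenbaum2015, GreenTao2010, HardyLittlewood1923,
MontgomeryVaughan2007]
#9 CornerIdentity (support) — PROVABLE NOW (exact, elementary): for every t, Ψ, K, N the function z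
↦ S_{Ψ,K,N}(z) is entire and S^{(t)}(0) = t!·vonMangoldtSum Ψ K N. Proof: d^{−z} = exp(−z log d) is
entire; for a lattice point with all ψ_i(n) ≥ 2 each factor f_i(z) = Σ_{d | ψ_i(n)} μ(d) d^{−z} has
f_i(0) = Σ μ(d) = 0 and f_i'(0) = −Σ μ(d) log d = Λ(ψ_i(n)) (Mathlib:
ArithmeticFunction.sum_moebius_mul_log_eq), so (Π_i f_i)^{(t)}(0) = t! Π_i f_i'(0) (general Leibniz,
only the all-ones multi-index survives); lattice points with some ψ_i(n) ≤ 1 contribute 0 on both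
sides (intVonMangoldt vanishes at m ≤ 1). [difficulty: provable-now] [Golomb1970,
BombieriAsymptoticSieve1976, Tenenbaum2015]
#9 TwoConstants (support) — PROVABLE NOW (pure complex analysis; the quantitative Vitali step): for
every k and r > 0 there are C ≥ 0 and θ > 0 (θ = log(5/3)/log 5, C = k!(8/r)^k work) such that every
f holomorphic on |z| < r with |f| ≤ M there and |f| ≤ δ ≤ M on the closed disc |z − r/4| ≤ r/8
satisfies |f^{(k)}(0)| ≤ C M^{1−θ} δ^θ. Proof: Hadamard three circles centred at r/4 with radii r/8
< 3r/8 < 5r/8 (the outer circle stays in |z| ≤ 7r/8; Mathlib: Complex.HadamardThreeLines, transport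
by w ↦ r/4 + e^w), maximum modulus on |z − r/4| ≤ 3r/8 ⊇ |z| ≤ r/8, then the Cauchy estimate on |z|
= r/8. [difficulty: provable-now] [Titchmarsh1986, AhlforsCA1979, Conway1978]
#9 SinglesDimOne (support) — PROVABLE NOW: the t = 1 slice of the d = 1 statement — for one form a n
+ b (0 < |a| ≤ L, |b| ≤ LN) and convex K ⊆ [−N, N], Σ_{n ∈ K∩ℤ} Λ(a n + b) = |K ∩ {a x + b >
0}|·(|a|/φ(|a|))·[gcd(a,b) = 1] + o(N) uniformly: the values form a progression of modulus |a| ≤ L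
inside [−2LN, 2LN], so this is the Siegel–Walfisz theorem for moduli ≤ L (tree, PROVED:
Literature.NumberTheory.LFunctions.siegel_walfisz_holds, via ParityWave0.chebyshevPsiMod) plus
interval bookkeeping; β_p = 1 (p ∤ a), p/(p−1) (p | a, p ∤ b), 0 (p | gcd). [difficulty:
provable-now] [Walfisz1936, IwaniecKowalski2004, GreenTao2010]
#1 Assembly (assembly) — PROVABLE NOW (the route's own theorem, restated in rev 2; bookkeeping + the
five supports + one landed theorem; replaces the rev-1 chain CornerExtraction → DimOne →
FibrationLemma and is consumed by `closes`): DiscGrowth → TrivialRegion → CornerContinuation →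
CornerIdentity → TwoConstants → SinglesDimOne → GeneralizedHardyLittlewood. Proof: FIRST the d = 1
statement for all t ≥ 1 (the hypothesis of the fibration theorem, verbatim): t = 1 is SinglesDimOne;
for t ≥ 2, L, ε: ρ from DiscGrowth, ρ₀ from CornerContinuation, r := min(ρ, ρ₀, 1); (C, θ) from
TwoConstants(t, r); (η, N₁) from TrivialRegion(σ := r/8); κ := ηθ/2; N₀ large. For N, Ψ, K take G
from CornerContinuation and D(z) := S(z)/N − (archFactor/N)·G(z), holomorphic on |z| < r; |D| ≤ N^κ
+ 2N^κ = 3N^κ there (archFactor ≤ 2N, K ⊆ [−N,N]); on |z − r/4| ≤ r/8 one has Re z ≥ r/8, |z| ≤ 3r/8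
≤ 1 and G = G_Ψ, so |D| ≤ N^{−η}; TwoConstants gives |D^{(t)}(0)| ≤ C(3N^κ)^{1−θ}N^{−ηθ}, and
D^{(t)}(0) = (t!/N)(vonMangoldtSum − archFactor·singularProduct) by CornerIdentity and
CornerContinuation (linearity of iteratedDeriv for functions holomorphic near 0), whence
|vonMangoldtSum − archFactor·singularProduct| ≤ (3C/t!) N^{1−ηθ(1+θ)/2} ≤ εN. THEN apply the PROVED
tree theorem
Summit.Parity.GeneralizedHardyLittlewood.Theorems.FibrationGlue.generalizedHardyLittlewood_of_dimOne
(Theorems/LeeYangFibresFibrationLemmaFinal.lean; the theorem that closed the shared item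
stmt-Parity-0822 on 2026-08-16, 4.6 kLoC, axioms standard). [difficulty: M] [Tenenbaum2015,
Titchmarsh1986, arXiv:0807.4739, GreenTao2010]
#9 TwinKill (support) — PROVABLE NOW (kill-path glue; pattern CwPowerHosting.CapacityGapRefutes):
¬TwinDiscGrowth → ¬DiscGrowth, the contrapositive of DiscGrowth (t = 2, L = 3) → TwinDiscGrowth.
Proof: Ψ = (n, n + 2) is non-degenerate (a·n = b·(n + 2) ∀ n forces a = b = 0) with ‖Ψ‖_N = 2 + 2/N
≤ 3 (N ≥ 2); K = {x : Fin 1 → ℝ | 2 ≤ x 0 ≤ N} is convex, ⊆ realBox 1 N, and on it both forms are ≥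
2, so each `if` takes the divisor-sum branch; n ↦ (n 0).toNat is a bijection from the filtered
latticeBox 1 N onto Finset.Icc 2 N carrying the summand to (Σ_{d | m} μ(d) d^{−z})(Σ_{e | m+2} μ(e)
e^{−z}); take the same ρ and N₀ ∨ 2. LANDING NOTE: land with it the literal `theorem
twinDiscGrowth_of_discGrowth : DiscGrowth → TwinDiscGrowth` so the closes-cone puts TwinDiscGrowth
on the kill path; a refuter's `¬ TwinDiscGrowth` then gives `¬ DiscGrowth` by name (close
refuted:DiscGrowth). [difficulty: S] [HardyLittlewood1923, GreenTao2010]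

TWO-LAYER PLAN. Foreseen glued splits (none filed now; k ≤ 3, depth 1): DiscGrowth ⇐ LeftArcGrowth
(the bound on {‖z‖ ≤ ρ, Re z ≤ 0} only) →
RightHalfTrivial (divisor bound on Re z ≥ 0, provable) → DiscGrowth; or, by mechanism, DiscGrowth ⇐
MainPartGrowth (box partial
sums of the Dirichlet series of G_Ψ are N^{o(1)} on the disc — a quasi-GRH-type statement about Σ
μ(d) d^{−1−z}) → RemainderGrowth
(the lattice-count remainders Σ_d Π μ(d_i) d_i^{−z} R(d), i.e. after divisor switching a
power-saving Chowla-type sum for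
μ(ψ_1(n))⋯μ(ψ_t(n)) with smooth weights, uniform in progressions) → DiscGrowth. Assembly ⇐
CornerExtractionDimOne (the d = 1
statement from the crux and the five supports: verbatim the rev-1 item CornerExtraction,
stmt-Parity-12803) → (one application of
the landed fibration theorem) → Assembly — not filed (the second child is a proved one-liner);
derivative bookkeeping / parameter choice inside the first child are `--supports` lemmas, never
items.

KILL CRITERIA. TwinDiscGrowth REFUTED (for every ρ > 0 some κ > 0 fails along a sequence of N)
refutes DiscGrowth (its L = 3 slice; machine path:
TwinKill_holds applied to the refuting theorem gives ¬DiscGrowth by name) and closes the route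
outright: `close --reason refuted:DiscGrowth`; the witness is news (an Ω-result N^{1+c} for a signed
binary divisor-type sum)
and is filed against every power-saving twin-HL statement. DiscGrowth refuted directly (e.g. by a
Goldbach-type or primorial-shift
family): same. The axis probe (rev-1 item AxisLimit, stmt-Parity-12797, dropped in the rev-2 repair
as neither load-bearing nor a
kill path; numerically confirmed 2026-08-15; statement kept under NOT DECOMPOSED YET (v)) refuted at
some τ₀ (limit exists and
differs, or does not exist) would still be informative: the continuation heuristic dies at o(1)
precision on the axis beyond |τ₀| —
a PIVOT signal, not a close (DiscGrowth only claims some ρ < |τ₀|); if the refutation mechanism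
scales to τ → 0 it predicts
¬DiscGrowth and the route is closed.
TrivialRegion / CornerContinuation / CornerIdentity / TwoConstants / SinglesDimOne refuted ⇒ a
bookkeeping misstatement (my
computations: E_p = Σ_I (−1)^{|I|} p^{−|I|z} ν_p(I)/p, generic E_p = 1 − t p^{−1−z}, β_p =
(1−1/p)^{−t}E_p(0), θ = log(5/3)/log 5,
η = min(σ/(4t), 1/4)) ⇒ re-file the repaired statement as a new item and re-certify the glue;
Assembly / TwinKill refuted ⇒
the same (they are compositions of the above with landed theorems). DimOne (the sibling routes' d =
1 node) proved elsewhere, or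
GHL decided either way, moots the route (close superseded).

NOT DECOMPOSED YET. (i) Any attack on DiscGrowth itself (the Main/Remainder split above; bilinear
structure of Σ_n Π J̃_z(ψ_i(n)) at Re z < 0; transfer
from F_q[T], where power-saving Chowla is a theorem, SawinShusterman2018) — layer 2, after refuters
have priced the crux. (ii) The
explicit constants η(σ,t), ρ₀(t), C(k,r) — existential in the items on purpose (a zero-free disc of
z ζ(1+z) of unspecified
radius suffices). (iii) The two-variable family Σ J̃_z(n) J̃_w(n+h) (all Λ_k ⊗ Λ_l correlations) and
the counting form Conj. 1.4
(Literature.NumberTheory.Sieve.generalizedHardyLittlewood_count_of_vonMangoldt) — not part of this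
route. (iv) The calibration
theorems 'DiscGrowth ⇒ power-saving d = 1 asymptotics' (two constants with the TrivialRegion rate)
and 'DiscGrowth at t = 1 ⇔
quasi-GRH for moduli ≤ L' (Landau: Σ J̃_z(m) m^{−s} = ζ(s)/ζ(s+z)) — recorded, deliberately not
filed (t = 1 is routed through
Siegel–Walfisz, so no GRH-type hypothesis enters at t = 1). (v) The AXIS PROBE (rev-1 item
AxisLimit,
stmt-Parity-12797, crux r4, dropped in the rev-2 repair 2026-08-17: not a hypothesis `closes`
consumes, not a kill path): for every
h ≥ 1 and real τ ≠ 0, N^{−1} Σ_{n ≤ N} J̃_{iτ}(n) J̃_{iτ}(n+h) → G_h(iτ) := ζ(1+iτ)^{−2} Π_p (1 −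
2p^{−1−iτ} + [p | h] p^{−1−2iτ})(1 −
p^{−1−iτ})^{−2} (Lean signature: rev-1 file, git 49602db00554); the first parity-sensitive point of
the deformation; numerically
CONFIRMED by refuter g41-1 (2026-08-15, N = 4·10^6, τ = h = 1, ratio 0.9995); for |τ| < ρ
it follows from DiscGrowth + TrivialRegion, beyond that it is an independent Elliott-type problem
for the unbounded J̃_{iτ} =
1∗(μ n^{−iτ}) (outside Klurman's bounded theorem, arXiv:1603.08453 Thm 3) — banked; re-file under
its own line if one consumes it. (vi) The d = 1 WAYPOINT: rev 1 carried DimOne (stmt-Parity-0819),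
FibrationLemma (0822, proved),
CornerExtraction (… → DimOne) and an Assembly def, and `closes` took DimOne as an unused hypothesis;
DimOne ⟺ GHL being a tree
theorem (Theorems.EngineToGHL.generalizedHardyLittlewood_iff_dimOne), that read as a restatement of
the summit and imported the
hides-summit flag of 0819's skeleton; rev 2 composes the extraction with the landed fibration
theorem (the restated Assembly), so the
open leaf of `closes` is DiscGrowth alone, plus provable supports.

CHEAPEST FALSIFIER. kit numerics on TwinDiscGrowth: for N = 10^6 … 10^9, ρ ∈ {0.05, 0.1, 0.15, 0.2},
tabulate the max over 64 points of |z| = ρ of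
|S(z)| = |Σ_{2≤n≤N} J̃_z(n)J̃_z(n+2)| (smallest-prime-factor sieve, O(N log log N) per z) against
the continued main term N·G_2(z),
G_2 = ζ(1+z)^{−2} Π_p (1 − 2p^{−1−z} + [p=2]p^{−1−2z})(1 − p^{−1−z})^{−2}: a deviation |S/N − G_2|
growing like N^{c}, c > 0, on the
left arc refutes TwinDiscGrowth empirically at that ρ (try smaller ρ first); decay like N^{−1/2+2|Re
z|} supports it. Miniature run (pure python, h = 2,
N ≤ 8·10^5, values under NUMBERS): S/N = G_2 to 4 digits on the right half and on the axis, within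
7·10^{−4} at z = −0.1, 0.022 at
z = −0.2, O(0.1) sign-changing oscillations at z = −0.25 = −1/(2t) — the square-root model;
log|S|/log N ≤ 0.86 everywhere tested;
refuter g41-1: |S| ≲ N at z = −σ ≤ 0.3, N ≤ 3·10^6. Decisive runs need N ≥ 10^8. Lookup
falsifier: a divisor-bounded Klurman Cor. 4 (arXiv:1603.08453 is for f, g : ℕ → 𝕌) would settle the
axis probe (v) — it does not bear on closes.

NUMBERS. 2C₂ = 1.3203236… (Literature.NumberTheory.Sieve.singularSeries_pair_holds); nearest zero of
ζ(1+z) at |z| ≈ 14.13 and no pole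
inside |z| < 1/2, so ρ₀ is limited only by t: bad Euler factors are ≤ exp(C p^{tρ₀−1}), hence ρ₀ <
1/t (we use 1/(4t)); trivial
bounds: |S(z)| ≤ N^{1+o(1)} on Re z ≥ 0 and ≤ N^{1+t|Re z|+o(1)} on Re z < 0, random-model
fluctuation N^{1/2+t|Re z|}, so
DiscGrowth is predicted exactly for ρ < 1/(2t) and every item says '∃ ρ > 0'; continued main term on
the left arc ≤ 2N·exp(C(log
N)^{tρ}) = N^{1+o(1)} for tρ < 1 (primorial shifts), which is why O(1)-normalised bounds were
abandoned; TwoConstants geometry: circles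
of radii r/8, 3r/8, 5r/8 about r/4, θ = log(5/3)/log 5 ≈ 0.317, C = k!(8/r)^k; TrivialRegion rate η
= min(σ/(4t), 1/4) with y =
N^{1/(2t)}; Assembly (d = 1 step) exponent 1 − ηθ(1+θ)/2 with κ = ηθ/2. Miniature numerics (h = 2):
G_2(0.3) = 0.08269 = S/N (N = 2·10^5);
G_2(0.25i) = −0.08827+0.02818i vs S/N = −0.08828+0.02854i (N = 8·10^5); G_2(−0.1) = 0.01378 vs S/N =
0.01313 … 0.01398; G_2(−0.2) =
0.04922 vs S/N ∈ [0.027, 0.059]; G_2(−0.25) = 0.06315 vs S/N ∈ [−0.044, 0.114] (N = 5·10^4 …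
8·10^5). Items at open: 12 (1 target, 3
cruxes, 7 supports, 1 assembly); after the rev-2 repair (2026-08-17): 9 = 2 cruxes (DiscGrowth r2,
the one load-bearing open research
leaf; TwinDiscGrowth r3, kill node) + 1 assembly (restated: the extraction run to the Statement,
consumed by `closes`) + 6
supports (TrivialRegion, CornerContinuation, CornerIdentity, TwoConstants, SinglesDimOne, TwinKill),
no target item.
Cone facts: 0 unproved named facts among the route's project constants (gate cone); the 16 of the
import-closure census
(bfi_wellFactorable_level, GreenTao2010_gowersUniformity, …) rode in on the rev-1 auto-import
Theorems.LeeYangFibresAssemblyClose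
(for FibrationLemma_holds), which rev 2 no longer needs — needs-fact: none.

DEFINITION REQUESTS. None: J̃_z, S_{Ψ,K,N} and G_Ψ are inlined in every signature (route files carry
no helper defs). When defn-GeneralizedHardyLittlewoodDimOne
(filed by DicksonFibration for stmt-Parity-0819) lands, nothing here changes: the d = 1 statement
occurs only inside Assembly's
proof obligation, spelled out over the Green–Tao dictionary exactly as the landed fibration theorem
expects it.

Novelty: Searches (2026-08-15, this unit): `lit galaxy search "correlations of multiplicative functions"
--star all` (18 rows: Tao
arXiv:1509.05363/1509.05422, Lichtman–Teräväinen arXiv:2111.08912, Tao–Teräväinen arXiv:2109.06291,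
Pandey–Woo arXiv:2304.14267 —
none on rank deformations); `lit galaxy search "Correlations of multiplicative functions and
applications" --star pdf` (3: Klurman
via Ng–Thom arXiv:1609.01411 additive divisor sums, Tao 1509.05422); `lit galaxy search "Jordan
totient function shifted" --star all`
(0 rows); `lit galaxy search "three circles theorem" --star pdf` (12, classical/PDE only); `lit read
arxiv:1603.08453` (Klurman,
Compositio 2017: Thm 3 / Cor. 4 are for f, g : ℕ → 𝕌 — bounded — so AxisLimit is not covered); `lit
vsearch` (Ingham σ_a σ_b shifted
sums: no relevant held text); `lit search` tier: searchd rc 75 all session (recorded). Inherited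
from the card and the gen-1 route
(same day): lit search --hybrid ×4, lit frontier Parity --since 2020 (21 rows), lit bridges Parity
--cross any (30 rows), refuter
triage: Golomb1970 (doi:10.1016/0022-314x(70)90019-3), Hindry–Rivoal 2005, Pontes thesis 2012
(Λ(n)Λ(n+h) = ½Λ₂(n(n+h)), stuck at a
limit interchange).
Nearest prior art found: Golomb1970 (the Λ₂-corner identity with an Abel variable, no open region,
no extraction theorem);
Tenenbaum2015 II.5 Selberg–Delange (Cauchy extraction in a complex exponent for ONE-point sums Σ
τ_z(n)); arXiv:0807.4739 (mod-φ
convergence: uniform bounds on a complex disc ⇒ asymptot  [refs: 10.1016/0022-314x(70, 1509.05363, 2111.08912, 2109.06291, 2304.14267, 1609.01411, 1603.08453, 0807.4739, arxiv:1603.08453, doi:10.1016/0022-314x, Golomb1970, Tenenbaum2015, BombieriAsymptoticSieve1976]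

Barriers (technique_class: continuation-in-rank normal-families jordan-deformation): - technique_class: continuation-in-rank normal-families jordan-deformation
- Literature.Barriers.Parity.SelbergParityBarrier: APPLIES to DiscGrowth/TwinDiscGrowth and is not
evaded there — on squarefree values J̃_z(m) = μ(m) m^{−z} J̃_{−z}(m), so the Liouville reweighting
reflects the disc z ↦ −z and maps the (trivial) right half onto N^{t|Re z|}× the left half: no
Type-I argument proves the left-half bound, which is exactly where the non-sieve input enters, as a
main-term-free BOUND; it does NOT apply to the deduction CornerExtraction (complex-analytic
interpolation, not a sieve identity) nor to the supports.
- Literature.Barriers.Parity.PrimePairParity: the weight-insertion test is passed honestly —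
inserting 1 − λ(ψ_1(n))λ(ψ_2(n)) destroys DiscGrowth (the hypothesis fails for the ghost), so the
deduction is not 'sieve-theoretic' in the barrier's sense; conceded that this makes DiscGrowth
parity-complete.
- Literature.Barriers.Parity.FordFixedLevelBarrier: no level of distribution anywhere (TrivialRegion
is absolutely convergent bookkeeping with moduli ≤ N^{1/2}); the barrier correctly predicts that
TrivialRegion cannot be pushed to Re z = 0 by distribution alone.
- Literature.Barriers.Parity.FordMaynardMinimalTypeII: consistent — DiscGrowth is Type-II-strength
information (cancellation in signed t-linear sums), supplied as a hypothesis, not circumvented.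
- Literature.Barriers.Parity.LogarithmicAveraging: Cesàro sums throughout; nothing log-averaged is
ever transferred to a

History (route lifecycle, newest last):
- 2026-08-16T04:13:32Z · AUTO-CRUX (backfill): DimOne — hypotheses of the deciding theorem that nothing in the route derives are cruxes (operator:999:1085951)
- 2026-08-17T11:56:10Z · skeleton.hides-summit: stub_twoFlatFactors (stmt-Parity-0819) ⟷ summit (accepted theorem in Summits/Parity/GeneralizedHardyLittlewood/Theorems/DicksonFibrationDimOneEquivalence.lean) (prover-line-stmt-Parity-0819-c2-0)
- 2026-08-17T12:27:21Z · rev 2: restated Assembly (stmt-Parity-12804) — route-repair(badge) rbadge-Parity-JordanCorner-e546d525 rev 2: restate Assembly := DiscGrowth → 5 supports → GeneralizedHardyLittlewood (extraction + landed fib (planner-rbadge-Parity-JordanCorner-e546d525-0)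
- 2026-08-17T12:27:21Z · rev 2: dropped DimOne, FibrationLemma, CornerExtraction, AxisLimit — route-repair(badge) rbadge-Parity-JordanCorner-e546d525 rev 2: restate Assembly := DiscGrowth → 5 supports → GeneralizedHardyLittlewood (extraction + landed fib (planner-rbadge-Parity-JordanCorner-e546d525-0)
- 2026-08-24T01:10:31Z · DORMANT — reconciler: no traction for 6.4 d (last activity item-evidence-added at 2026-08-17T14:53:27Z); parked, not closed — `ledger route dormant route-Parity-JordanCor (operator:999:622448)

sub-problem: GeneralizedHardyLittlewood · status: dormant · opened planner-plancard-Parity-GeneralizedHardyLittl-56d27232-g2-0 2026-08-15T18:59:01Z · rev 5 · ledger route-Parity-JordanCorner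
GENERATED by the gate from the ledger (D-0016/17). Provers cite these decls: `theorem foo : Summit.Parity.GeneralizedHardyLittlewood.Theses.JordanCorner.<Decl> := …` in Summits/Parity/GeneralizedHardyLittlewood/Theorems/<Name>.lean.
-/

namespace Summit.Parity.GeneralizedHardyLittlewood.Theses.JordanCorner

open scoped BigOperators Topology Manifold Classical MeasureTheory ProbabilityTheory Matrix InnerProductSpace ComplexConjugate ContinuousMap
open Filter Set Function TopologicalSpace MeasureTheory

attribute [summit_statement] _root_.GeneralizedHardyLittlewood

/-- item stmt-Parity-12795 · crux · rank 2 · open · by planner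
why it might fail: ≥ quasi-RH: the landed discGrowth_oneFormGrowth (shift averaging of the t=2, L=3 slices) + Landau force ζ(s) ≠ 0 on Re s > 1−ρ; at z=−ρ it is a power saving in a (−1)^ω-signed t-fold correlation uniform in shifts ≤ LN (none known over ℤ); an aligned Siegel zero mod q ≤ N^{tρ−κ} violates it.
sources: TaoFMP2016, SawinShusterman2018, BombieriAsymptoticSieve1976, MatomakiMerikoski2023, arXiv:2109.06291, BhowmikRuzsa2018
[crux] (card Crux 1 = H(ρ), uniformised and in growth form) for every t ≥ 2 and L there is ρ > 0
such that for every κ > 0, all N ≥ N₀(t,L,κ), every non-degenerate Ψ = (a_i n + b_i)_{i<t} with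
‖Ψ‖_N ≤ L, every convex K ⊆ [−N, N] and every ‖z‖ ≤ ρ: |Σ_{n ∈ K∩ℤ} Π_i J̃_z(ψ_i(n))| ≤ N^{1+κ},
J̃_z(m) = Σ_{d|m} μ(d) d^{−z} for m ≥ 2 (0 otherwise). Trivial for Re z ≥ 0 (divisor bound); at z =
−σ' < 0 the trivial bound is N^{1+tσ'+o(1)} and J̃_{−σ'}(m) = Π_{p|m}(1 − p^{σ'}) =
(−1)^{ω(m)}·(positive weight ≤ m^{σ'}), so the content is a power saving N^{tσ'−κ} in a
Liouville-type signed t-fold correlation of linear forms, uniformly in shifts ≤ L·N and intervals —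
supplied as a pure BOUND with no main term and no singular series. [difficulty: open-problem] -/
@[route_item "route-Parity-JordanCorner", crux]
def DiscGrowth : Prop :=
  ∀ t : ℕ, 2 ≤ t → ∀ L : ℕ, ∃ ρ : ℝ, 0 < ρ ∧ ∀ κ : ℝ, 0 < κ → ∃ N₀ : ℕ, ∀ N : ℕ, N₀ ≤ N → ∀ Ψ : Fin t → Literature.NumberTheory.Sieve.AffLinForm 1, Literature.NumberTheory.Sieve.IsNondegenerateSystem Ψ → Literature.NumberTheory.Sieve.affLinSize Ψ N ≤ L → ∀ K : Set (Fin 1 → ℝ), Convex ℝ K → K ⊆ Literature.NumberTheory.Sieve.realBox 1 N → ∀ z : ℂ, ‖z‖ ≤ ρ → ‖∑ n ∈ (Literature.NumberTheory.Sieve.latticeBox 1 N).filter (fun n => Literature.NumberTheory.Sieve.realPoint n ∈ K), ∏ i : Fin t, (if (Ψ i).eval n < 2 then (0 : ℂ) else ∑ d ∈ Nat.divisors ((Ψ i).eval n).toNat, (ArithmeticFunction.moebius d : ℂ) * ((d : ℕ) : ℂ) ^ (-z))‖ ≤ (N : ℝ) ^ (1 + κ)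

/-- item stmt-Parity-12796 · crux · rank 3 · open · by planner
why it might fail: at z=−ρ: a power saving N^{2ρ−κ} in Σ(−1)^{ω(n)+ω(n+2)}w(n)w(n+2) — nothing beyond log-averaged o(1) is known for binary Liouville sums over ℤ (TaoFMP2016); forces power-saving twin HL; as typed (∃ρ ∀κ ∃N₀) only an Ω-theorem, not numerics, refutes it.
sources: TaoFMP2016, HardyLittlewood1923, SawinShusterman2018, MatomakiRadziwillTao2019, Literature.Barriers.Parity.SelbergParityBarrier
[crux] the twin slice (t = 2, Ψ = (n, n+2), K = [2, N]) of DiscGrowth, filed separately as the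
route's falsifier node and first milestone: there is ρ > 0 such that for every κ > 0 and N ≥ N₀(κ),
sup_{‖z‖ ≤ ρ} |Σ_{2 ≤ n ≤ N} J̃_z(n) J̃_z(n+2)| ≤ N^{1+κ}. Implied by DiscGrowth (L = 3); by the
fixed-shift corner argument (gen-1 TrivialRegion + CornerContinuation + TwoConstants) it gives Σ_{n
≤ N} Λ(n)Λ(n+2) = 2C₂N + O(N^{1−c}), so it is at least power-saving twin-HL strong; it is the
statement the kit numerics test. [difficulty: open-problem] -/
@[route_item "route-Parity-JordanCorner"]
def TwinDiscGrowth : Prop :=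
  ∃ ρ : ℝ, 0 < ρ ∧ ∀ κ : ℝ, 0 < κ → ∃ N₀ : ℕ, ∀ N : ℕ, N₀ ≤ N → ∀ z : ℂ, ‖z‖ ≤ ρ → ‖∑ n ∈ Finset.Icc 2 N, (∑ d ∈ Nat.divisors n, (ArithmeticFunction.moebius d : ℂ) * ((d : ℕ) : ℂ) ^ (-z)) * (∑ e ∈ Nat.divisors (n + 2), (ArithmeticFunction.moebius e : ℂ) * ((e : ℕ) : ℂ) ^ (-z))‖ ≤ (N : ℝ) ^ (1 + κ)

/-- item stmt-Parity-12798 · support · rank 9 · open · by planner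
sources: Ingham1942, Tenenbaum2015, MontgomeryVaughan2007, GreenTao2010
[support] PROVABLE NOW (uniform (K) with a power rate): for t ≥ 1, L, σ > 0 there are η = η(t,L,σ) >
0 and N₀ with ‖S_{Ψ,K,N}(z) − archFactor(Ψ,K)·G_Ψ(z)‖ ≤ N^{1−η} for all N ≥ N₀, all non-degenerate Ψ
with ‖Ψ‖_N ≤ L, all convex K ⊆ [−N,N] and all z with Re z ≥ σ, |z| ≤ 1, where G_Ψ(z) = Σ_{d : Fin t
→ ℕ} Π_i μ(d_i) d_i^{−z}·dens_Ψ(d), dens_Ψ(d) = #{m mod Π d_i : d_i | ψ_i(m) ∀ i}/Π d_i (absolutely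
convergent for Re z > 0, uniformly: dens ≤ Π_{p | lcm, p > L} p^{−1}, (2^t−1)^{ω(D)} tuples per lcm
D). Proof: truncate each J̃ at d ≤ y = N^{1/(2t)} (tail ≤ τ(m) y^{−σ}, Σ_n Π τ(ψ_i(n)) ≤
N^{1+o(1)}); the head is a sum over admissible classes mod Π d_i of lattice points of the interval K
∩ {ψ_i ≥ 2} (count = length·dens + O(#classes + 1), #classes ≤ C_L Π d_i/lcm, Σ_{d ≤ y} Π d_i/lcm ≪
y^t log^c y); |length − archFactor| ≤ 2t; series tail ≪ y^{−σ} log^c; total ≪ N^{1−σ/(2t)+o(1)} +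
N^{1/2+o(1)}. [difficulty: provable-now] -/
@[route_item "route-Parity-JordanCorner", crux]
def TrivialRegion : Prop :=
  ∀ t : ℕ, 1 ≤ t → ∀ L : ℕ, ∀ σ : ℝ, 0 < σ → ∃ η : ℝ, 0 < η ∧ ∃ N₀ : ℕ, ∀ N : ℕ, N₀ ≤ N → ∀ Ψ : Fin t → Literature.NumberTheory.Sieve.AffLinForm 1, Literature.NumberTheory.Sieve.IsNondegenerateSystem Ψ → Literature.NumberTheory.Sieve.affLinSize Ψ N ≤ L → ∀ K : Set (Fin 1 → ℝ), Convex ℝ K → K ⊆ Literature.NumberTheory.Sieve.realBox 1 N → ∀ z : ℂ, σ ≤ z.re → ‖z‖ ≤ 1 → ‖(∑ n ∈ (Literature.NumberTheory.Sieve.latticeBox 1 N).filter (fun n => Literature.NumberTheory.Sieve.realPoint n ∈ K), ∏ i : Fin t, (if (Ψ i).eval n < 2 then (0 : ℂ) else ∑ d ∈ Nat.divisors ((Ψ i).eval n).toNat, (ArithmeticFunction.moebius d : ℂ) * ((d : ℕ) : ℂ) ^ (-z))) - (Literature.NumberTheory.Sieve.archFactor Ψ K : ℂ) * ∑' d : Fin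 t → ℕ, (∏ i, ((ArithmeticFunction.moebius (d i) : ℂ) * ((d i : ℕ) : ℂ) ^ (-z))) * ((((Finset.range (∏ i, d i)).filter (fun m : ℕ => ∀ i, ((d i : ℕ) : ℤ) ∣ (Ψ i).eval (fun _ => (m : ℤ)))).card : ℂ) / ((∏ i, d i : ℕ) : ℂ))‖ ≤ (N : ℝ) ^ (1 - η)

/-- item stmt-Parity-12799 · support · rank 9 · open · by planner
sources: Tenenbaum2015, GreenTao2010, HardyLittlewood1923, MontgomeryVaughan2007
[support] PROVABLE NOW: for t ≥ 1 and L there is ρ₀ > 0 (ρ₀ = min(1/(4t), r_ζ) works, r_ζ a radius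
on which z ζ(1+z) ≠ 0) such that for every κ > 0, N ≥ N₀(t,L,κ) and non-degenerate Ψ with ‖Ψ‖_N ≤ L
there is G holomorphic on |z| < ρ₀ with: G = G_Ψ (the series of TrivialRegion) where Re z > 0;
G^{(t)}(0) = t!·singularProduct Ψ; |G| ≤ N^κ on the ball. Proof: CRT makes d ↦ Π μ(d_i) dens_Ψ(d)
multiplicative, G_Ψ(z) = Π_p E_p(z), E_p(z) = Σ_{I ⊆ [t]} (−1)^{|I|} p^{−|I|z} ν_p(I)/p (ν_p(I) =
#{m mod p : p | ψ_i(m), i ∈ I}, ν_p(∅)/p := 1); for p ∤ Π a_i Π_{i<j}(a_i b_j − a_j b_i): E_p = 1 −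
t p^{−1−z}, so G = ζ(1+z)^{−t} H_Ψ, H_Ψ = Π_p E_p(1 − p^{−1−z})^{−t} absolutely convergent on Re z >
−1/2; ζ(1+z)^{−1} = z + O(z²) gives G^{(t)}(0) = t! H_Ψ(0) = t! Π_p β_p(Ψ) (β_p = (1−1/p)^{−t} Σ_I
(−1)^{|I|} ν_p(I)/p by inclusion–exclusion = localFactor; ordered product = singularProduct via
tendsto_singularProductPartial_holds); growth: bad primes p > L have ν_p(I) ≤ 1,
|E_p(1−p^{−1−z})^{−t}| ≤ exp(C_t p^{tρ₀−1}), and Σ_{p | Δ} p^{−3/4} ≪ (t² log(LN))^{1/4}, whence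
|H_Ψ| ≤ exp(C (log N)^{1/4}) ≤ N^κ. [difficulty: provable-now] -/
@[route_item "route-Parity-JordanCorner", crux]
def CornerContinuation : Prop :=
  ∀ t : ℕ, 1 ≤ t → ∀ L : ℕ, ∃ ρ₀ : ℝ, 0 < ρ₀ ∧ ∀ κ : ℝ, 0 < κ → ∃ N₀ : ℕ, ∀ N : ℕ, N₀ ≤ N → ∀ Ψ : Fin t → Literature.NumberTheory.Sieve.AffLinForm 1, Literature.NumberTheory.Sieve.IsNondegenerateSystem Ψ → Literature.NumberTheory.Sieve.affLinSize Ψ N ≤ L → ∃ G : ℂ → ℂ, DifferentiableOn ℂ G (Metric.ball 0 ρ₀) ∧ (∀ z ∈ Metric.ball (0 : ℂ) ρ₀, 0 < z.re → G z = ∑' d : Fin t → ℕ, (∏ i, ((ArithmeticFunction.moebius (d i) : ℂ) * ((d i : ℕ) : ℂ) ^ (-z))) * ((((Finset.range (∏ i, d i)).filter (fun m : ℕ => ∀ i, ((d i : ℕ) : ℤ) ∣ (Ψ i).eval (fun _ => (m : ℤ)))).card : ℂ) / ((∏ i, d i : ℕ) : ℂ))) ∧ iteratedDeriv t G 0 =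 (t.factorial : ℂ) * (Literature.NumberTheory.Sieve.singularProduct Ψ : ℂ) ∧ ∀ z ∈ Metric.ball (0 : ℂ) ρ₀, ‖G z‖ ≤ (N : ℝ) ^ κ

/-- item stmt-Parity-12800 · support · rank 9 · open · by planner
sources: Golomb1970, BombieriAsymptoticSieve1976, Tenenbaum2015
[support] PROVABLE NOW (exact, elementary): for every t, Ψ, K, N the function z ↦ S_{Ψ,K,N}(z) is
entire and S^{(t)}(0) = t!·vonMangoldtSum Ψ K N. Proof: d^{−z} = exp(−z log d) is entire; for a
lattice point with all ψ_i(n) ≥ 2 each factor f_i(z) = Σ_{d | ψ_i(n)} μ(d) d^{−z} has f_i(0) = Σ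
μ(d) = 0 and f_i'(0) = −Σ μ(d) log d = Λ(ψ_i(n)) (Mathlib:
ArithmeticFunction.sum_moebius_mul_log_eq), so (Π_i f_i)^{(t)}(0) = t! Π_i f_i'(0) (general Leibniz,
only the all-ones multi-index survives); lattice points with some ψ_i(n) ≤ 1 contribute 0 on both
sides (intVonMangoldt vanishes at m ≤ 1). [difficulty: provable-now] -/
@[route_item "route-Parity-JordanCorner", crux]
def CornerIdentity : Prop :=
  ∀ (t : ℕ) (Ψ : Fin t → Literature.NumberTheory.Sieve.AffLinForm 1) (K : Set (Fin 1 → ℝ)) (N : ℕ), Differentiable ℂ (fun z : ℂ => ∑ n ∈ (Literature.NumberTheory.Sieve.latticeBox 1 N).filter (fun n => Literature.NumberTheory.Sieve.realPoint n ∈ K), ∏ i : Fin t, (if (Ψ i).eval n < 2 then (0 : ℂ) else ∑ d ∈ Nat.divisors ((Ψ i).eval n).toNat, (ArithmeticFunction.moebius d : ℂ) * ((d : ℕ) : ℂ) ^ (-z))) ∧ iteratedDeriv t (fun z : ℂ => ∑ n ∈ (Literature.NumberTheory.Sieve.latticeBox 1 N).filter (fun n => Literature.NumberTheory.Sieve.realPoint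 n ∈ K), ∏ i : Fin t, (if (Ψ i).eval n < 2 then (0 : ℂ) else ∑ d ∈ Nat.divisors ((Ψ i).eval n).toNat, (ArithmeticFunction.moebius d : ℂ) * ((d : ℕ) : ℂ) ^ (-z))) 0 = (t.factorial : ℂ) * (Literature.NumberTheory.Sieve.vonMangoldtSum Ψ K N : ℂ)

/-- item stmt-Parity-12801 · support · rank 9 · open · by planner
sources: Titchmarsh1986, AhlforsCA1979, Conway1978
[support] PROVABLE NOW (pure complex analysis; the quantitative Vitali step): for every k and r > 0
there are C ≥ 0 and θ > 0 (θ = log(5/3)/log 5, C = k!(8/r)^k work) such that every f holomorphic on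
|z| < r with |f| ≤ M there and |f| ≤ δ ≤ M on the closed disc |z − r/4| ≤ r/8 satisfies |f^{(k)}(0)|
≤ C M^{1−θ} δ^θ. Proof: Hadamard three circles centred at r/4 with radii r/8 < 3r/8 < 5r/8 (the
outer circle stays in |z| ≤ 7r/8; Mathlib has the three-lines theorem Complex.HadamardThreeLines,
transport by w ↦ r/4 + e^w), maximum modulus on |z − r/4| ≤ 3r/8 ⊇ |z| ≤ r/8, then the Cauchy
estimate on |z| = r/8. [difficulty: provable-now] -/
@[route_item "route-Parity-JordanCorner", crux]
def TwoConstants : Prop :=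
  ∀ (k : ℕ) (r : ℝ), 0 < r → ∃ C θ : ℝ, 0 < θ ∧ 0 ≤ C ∧ ∀ (f : ℂ → ℂ) (M δ : ℝ), DifferentiableOn ℂ f (Metric.ball 0 r) → 0 < δ → δ ≤ M → (∀ z ∈ Metric.ball (0 : ℂ) r, ‖f z‖ ≤ M) → (∀ z ∈ Metric.closedBall ((r / 4 : ℝ) : ℂ) (r / 8), ‖f z‖ ≤ δ) → ‖iteratedDeriv k f 0‖ ≤ C * M ^ (1 - θ) * δ ^ θ

/-- item stmt-Parity-12802 · support · rank 9 · open · by planner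
sources: Walfisz1936, IwaniecKowalski2004, GreenTao2010
[support] PROVABLE NOW: the t = 1 slice of DimOne — for one form a n + b (0 < |a| ≤ L, |b| ≤ LN) and
convex K ⊆ [−N, N], Σ_{n ∈ K∩ℤ} Λ(a n + b) = |K ∩ {a x + b > 0}|·(|a|/φ(|a|))·[gcd(a,b) = 1] + o(N)
uniformly: the values form a progression of modulus |a| ≤ L inside [−2LN, 2LN], so this is the
Siegel–Walfisz theorem for moduli ≤ L (tree, PROVED:
Literature.NumberTheory.LFunctions.siegel_walfisz_holds, via ParityWave0.chebyshevPsiMod) plus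
interval bookkeeping; β_p = 1 (p ∤ a), p/(p−1) (p | a, p ∤ b), 0 (p | gcd). [difficulty:
provable-now] -/
@[route_item "route-Parity-JordanCorner", crux]
def SinglesDimOne : Prop :=
  ∀ L : ℕ, ∀ ε : ℝ, 0 < ε → ∃ N₀ : ℕ, ∀ N : ℕ, N₀ ≤ N → ∀ Ψ : Fin 1 → Literature.NumberTheory.Sieve.AffLinForm 1, Literature.NumberTheory.Sieve.IsNondegenerateSystem Ψ → Literature.NumberTheory.Sieve.affLinSize Ψ N ≤ L → ∀ K : Set (Fin 1 → ℝ), Convex ℝ K → K ⊆ Literature.NumberTheory.Sieve.realBox 1 N → |Literature.NumberTheory.Sieve.vonMangoldtSum Ψ K N - Literature.NumberTheory.Sieve.archFactor Ψ K * Literature.NumberTheory.Sieve.singularProduct Ψ| ≤ ε * (N : ℝ)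

/-- item stmt-Parity-18175 · support · rank 9 · open · by planner
sources: HardyLittlewood1923, GreenTao2010
[support] PROVABLE NOW — KILL-PATH GLUE (established pattern: CwPowerHosting.CapacityGapRefutes /
NOFWindowCapacity.GapKillsThesis): ¬TwinDiscGrowth → ¬DiscGrowth, the contrapositive of the slice
implication DiscGrowth (t = 2, L = 3) → TwinDiscGrowth. Proof: the twin system Ψ = (n, n + 2)
(coefficients 1, constants 0 and 2) is non-degenerate (a·n = b·(n + 2) for all n forces a = b = 0)
and ‖Ψ‖_N = 2 + 2/N ≤ 3 for N ≥ 2; K = {x : Fin 1 → ℝ | 2 ≤ x 0 ≤ N} is convex and ⊆ realBox 1 N; on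
K both forms are ≥ 2, so each `if` takes the divisor-sum branch, and n ↦ (n 0).toNat is a bijection
from the filtered latticeBox 1 N onto Finset.Icc 2 N carrying the summand to (Σ_{d | m} μ(d)
d^{−z})(Σ_{e | m+2} μ(e) e^{−z}); take the same ρ and the threshold N₀ ∨ 2. LANDING NOTE: land
together with `theorem … : TwinKill` the literal form `theorem twinDiscGrowth_of_discGrowth :
DiscGrowth → TwinDiscGrowth` (plain --kind proof) so the closes-cone records TwinDiscGrowth on the
kill path of `closes`; a refuter's `¬ TwinDiscGrowth` then yields `¬ DiscGrowth` by name and the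
route closes refuted:DiscGrowth (KILL CRITERIA). [deps: DiscGrowth, TwinDiscGrowth] [difficulty: S] -/
@[route_item "route-Parity-JordanCorner"]
def TwinKill : Prop :=
  ¬ TwinDiscGrowth → ¬ DiscGrowth

-- earlier Assembly (stmt-Parity-12804, replaced 2026-08-17T12:27:21Z -> stmt-Parity-18174): retired by None — DiscGrowth → TrivialRegion → CornerContinuation → CornerIdentity → TwoConstants → SinglesDimOne → FibrationLemma → GeneralizedHardyLittlewood
/-- item stmt-Parity-18174 · assembly · rank 1 · open · by planner
sources: GreenTao2010, Tenenbaum2015, arXiv:0807.4739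
[assembly] PROVABLE NOW (the route's own theorem, restated in rev 2 and consumed by `closes`;
bookkeeping + the five supports + one landed theorem; replaces the rev-1 chain CornerExtraction →
DimOne → FibrationLemma → GeneralizedHardyLittlewood): DiscGrowth → TrivialRegion →
CornerContinuation → CornerIdentity → TwoConstants → SinglesDimOne → GeneralizedHardyLittlewood.
Proof: FIRST the d = 1 statement for all t ≥ 1 (∀ t L, 1 ≤ t → ∀ ε > 0 ∃ N₀ ∀ N ≥ N₀ ∀
non-degenerate Ψ : Fin t → AffLinForm 1 with affLinSize Ψ N ≤ L ∀ convex K ⊆ realBox 1 N,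
|vonMangoldtSum Ψ K N − archFactor Ψ K · singularProduct Ψ| ≤ ε N — verbatim the hypothesis of the
fibration theorem): t = 1 is SinglesDimOne. For t ≥ 2, L, ε: ρ from DiscGrowth, ρ₀ from
CornerContinuation, r := min(ρ, ρ₀, 1); (C, θ) from TwoConstants(t, r); (η, N₁) from TrivialRegion(σ
:= r/8); κ := ηθ/2; N₀ large. For N, Ψ, K take G from CornerContinuation and D(z) := S(z)/N −
(archFactor/N)·G(z), holomorphic on |z| < r; |D| ≤ N^κ + 2N^κ = 3N^κ there (archFactor ≤ 2N since K
⊆ [−N,N]); on |z − r/4| ≤ r/8 one has Re z ≥ r/8, |z| ≤ 3r/8 ≤ 1 and G = G_Ψ, so |D| ≤ N^{−η} by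
TrivialRegion; TwoConstants gives |D^{(t)}(0)| ≤ C(3N^κ)^{1−θ}N^{−ηθ}, -/
@[route_item "route-Parity-JordanCorner", crux]
def Assembly : Prop :=
  DiscGrowth → TrivialRegion → CornerContinuation → CornerIdentity → TwoConstants → SinglesDimOne → GeneralizedHardyLittlewood

-- records of items no longer active in this route (dropped / restated):
-- earlier FibrationLemma (stmt-Parity-0822, dropped 2026-08-17T12:27:21Z): proved by Summit.Parity.GeneralizedHardyLittlewood.Theorems.leeYangFibres_fibrationLemma — DimOne → GeneralizedHardyLittlewood

/-! D-0027 §2.1 — DECIDING THEOREM (planner-authored via `route open/edit --closes-file`; by planner-rbadge-Parity-JordanCorner-e546d525-0 2026-08-17T12:27:21Z):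
its hypotheses are this route's items and its conclusion the sub-problem Statement (glue_lint), and it elaborates with this file. -/

/-- D-0027 §2.1 deciding theorem of route JordanCorner (rev 2): the crux `DiscGrowth` and the provable supports
`TrivialRegion`, `CornerContinuation`, `CornerIdentity`, `TwoConstants`, `SinglesDimOne` give the sub-problem Statement through
the route's assembly item `Assembly` (two-constants extraction of the corner Taylor coefficient of the uniform Jordan
deformation to the `d = 1` asymptotics for every `t`, followed by the PROVED fibration theorem
`Theorems.FibrationGlue.generalizedHardyLittlewood_of_dimOne`). Every binder is consumed; `TwinDiscGrowth` (kill node, wired by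
`TwinKill : ¬ TwinDiscGrowth → ¬ DiscGrowth`) is deliberately not a hypothesis. -/
@[closes "route-Parity-JordanCorner"] theorem closes (h2 : DiscGrowth) (h5 : TrivialRegion) (h6 : CornerContinuation) (h7 : CornerIdentity) (h8 : TwoConstants)
    (h9 : SinglesDimOne) (hA : Assembly) : _root_.GeneralizedHardyLittlewood :=
  hA h2 h5 h6 h7 h8 h9

end Summit.Parity.GeneralizedHardyLittlewood.Theses.JordanCorner
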